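/-
Copyright: the b2b-balaban T⁴-continuum CRUX team, row NE7b leaf lineage `t4-ne7b-formalise-leaf-03` (gen 143). Project licence.
-/
import Mathlib.MeasureTheory.Group.Integral
import Mathlib.MeasureTheory.Integral.Bochner.Set
import Mathlib.Analysis.SpecialFunctions.Log.Basic
import Mathlib.Analysis.Convex.Function

/-!
# THE MINIMISER-ADAPTED (SHEARED) CHART COSTS NOTHING UNDER THE FIBRE INTEGRAL: the windowed marginal over a SHEARED window
# `K_ψ = {(x, y) : x ∈ B, y − ψ(x) ∈ F}` IS the windowed marginal of the sheared exponent `Ṽ(x, w) = V(x, ψ(x) + w)` over the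
# PRODUCT window `B × F` — pointwise in `x`, for ANY shear `ψ` (no linearity, no Jacobian), by translation invariance on each fibre
# (row NE7b, node U5c; residual (R2′) family (2), the «chart» item of the (A3) reading; kernel lemmas of measure theory)

Cell `pub-balaban`, sub-cell `t4`, spine estimate NE7b (`T4WeightBudget.RelWeightBound`; the cell's OWN estimate — NOT PRINTED in
[Bałaban 1983–89], NOT PROVED).  Crux-route work under `Spine/NE7b/` by a row leaf on the convexity road; NOTHING of Bałaban's is named
or asserted; no `T4Continuum/Support` leaf typed; no `def`; zero `sorry`.  Imports: Mathlib only — independent of the farm's olean frontier.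

WHY.  The road's marginal tools are strongest on PRODUCT windows `B × F` (`…LogConcaveMarginal` §6 with `…ConvexityModulusSchur`,
`…LogConcaveMarginalDeriv`, `…FibreWindowSmooth`, leaf-05's `SemiconcaveMarginal`, leaf-06's `FibreWindowHessian`): the fibre window is
FIXED and only the exponent moves with the base point.  The located reading of the template (chair leaf-05 g149, R-A3-leaf05-g149-1:
Dimock, arXiv:1108.1335 §4, (184)–(209)) says this is the printed situation AFTER the change of variables `Φ_k = Ψ_k(Φ_{k+1}) + C_k^{1∕2}W`
— the fluctuation window `{|W| ≤ p_{0,k}}` is a fixed box in the fluctuation variable, reached from the original variables by a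
FIBREWISE TRANSLATION by the (background-dependent) minimiser; the refuter's v101 §3¹⁰¹ books «(ii) the chart» (print's windows are
products only in the minimiser-adapted chart) as one of R-P1's three by-value debts.  In the original variables such a window is the
SHEARED set `K_ψ = {(x, y) : x ∈ B, y − ψ(x) ∈ F}` — in general NOT convex, NOT a product — so the product-window theorems do not apply
to `V` on `K_ψ` literally.  THIS FILE records that they need not: Lebesgue (any add-right-invariant) measure on each fibre is translation
invariant, so the fibre integral of `e^{−V(x, ·)}` over `(K_ψ)_x = ψ(x) + F` EQUALS the fibre integral of `e^{−Ṽ(x, ·)}` over `F` with the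
sheared exponent `Ṽ(x, w) = V(x, ψ(x) + w)`, for EVERY shear `ψ : X → Y` (measurable or not, linear or not) — no Jacobian, because the
chart is a translation on each fibre.  Hence the windowed marginals of `(V, K_ψ)` and `(Ṽ, B × F)` are THE SAME FUNCTION on `B`, and every
secant ∕ convexity ∕ derivative statement the road proves for `Ṽ` on the product window is, verbatim, the statement for `V` on the
sheared window.  What the instance then owes is displayed where it belongs: the joint letter for the SHEARED exponent `Ṽ` on `B × F`
(the «chart term» `DV·Dψ`, `D²V[Dψ·, Dψ·]`, … of the (A3) reading) — not a convexity property of `K_ψ`.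

WHAT IS PROVED ([folklore] measure theory; Mathlib's `integral_sub_right_eq_self` ∕ `integral_indicator` BY NAME):
* §1 fibres: `fibre_shearedWindow_of_mem` (`(K_ψ)_x = (· − ψ x)⁻¹' F` for `x ∈ B`), `fibre_shearedWindow_of_not_mem` (`= ∅` off `B`),
  `measurableSet_shearedWindow` (`ψ`, `B`, `F` measurable).
* §2 translation on one fibre (`Y` a measurable additive group, `μ` add-right-invariant): `setIntegral_preimage_sub_const`
  (`∫_{(· − c)⁻¹' F} g dμ = ∫_F g(c + w) dμ(w)`), `integrableOn_preimage_sub_const_iff`.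
* §3 THE IDENTITY: `setIntegral_fibre_shearedWindow` — for `x ∈ B`,
  `∫_{(K_ψ)_x} f(x, y) dμ(y) = ∫_{(B ×ˢ F)_x} f(x, ψ x + w) dμ(w)`; `integrableOn_fibre_shearedWindow_iff`; the (26)-§6 side letters
  transfer: `shearedWindow_hint_iff`, `shearedWindow_hpos_iff`.
* §4 `marginal_eqOn_sheared` (the two marginals are ONE function on `B`, `Set.EqOn`) and `convexOn_marginal_sheared_iff` (`ConvexOn ℝ B`
  transfers); END `marginal_secant_of_sheared` — ANY two-point inequality between the values `−log ∫_{(B ×ˢ F)_x} e^{−Ṽ(x, ·)}` at `x₀, x₁,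
  a x₀ + b x₁ ∈ B` (e.g. the conclusion of `…LogConcaveMarginal.neg_log_fibreIntegral_secant_of_baseForm` for `Ṽ` on `B ×ˢ F`) IS the same
  inequality for `−log ∫_{(K_ψ)_x} e^{−V(x, ·)}` — stated as a rewriting lemma `neg_log_fibreIntegral_shearedWindow_eq` plus the secant
  form, so no road file is imported.
* §5 (v1.2) **`secantForm_sheared_of_fibreLipschitz`** — THE CHART TERM IN SECANT CURRENCY: `V` with the base-form
  letter `S` on a convex `K`, `G`-Lipschitz in the fibre direction on `K`, shear with secant defect `‖ψ(a x₀ + b x₁) − (aψ x₀ + bψ x₁)‖ ≤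
  a·b·κ(x₁ − x₀)` on `B`, chart into `K` ⟹ the sheared exponent `Ṽ` obeys the base-form letter on `B ×ˢ F` with the DEGRADED form
  `S − G·κ` (verbatim `…LogConcaveMarginal` §6's `hVc` for `Ṽ`): a nonlinear minimiser-adapted chart costs `G·κ` of base modulus,
  small exactly when the window hugs the fibre minimiser (`D_yV ≈ 0`).

NOT HERE (honest): which shear (Bałaban's background-dependent minimiser and the `C_k^{1∕2}` normalisation), which windows, and the joint
letter for the sheared exponent — (A3) ∕ (A1c), NC-NE7b-α UNRULED; linear split charts with a non-trivial linear part are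
`…EuclideanCarrierSplit` (measure-preserving isometries) and compose with this file's translations; anything of Bałaban's.  BY-NAME EFFECT
ON THE WALL: NONE.  NE7b NOT PRINTED ∕ NOT PROVED; spine PROVED 0∕9; rung (B)+1 on a FINITE torus — NOT infinite volume, NOT the mass gap,
NOT Clay.
HONEST DEPENDENCY: continuum YM on T⁴ ⇐ BetaPertH ∧ nine spine estimates (0/9 proved); BetaPertH ⇐ (D1) ∧ (D4) ∧ CAP+tail.
-/

set_option autoImplicit false

open MeasureTheory Set

namespace Summit.QuantumFields.BalabanUV.T4Continuum.NE7b.ShearedWindowMarginal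

/-! ## §1 The sheared window `K_ψ = {(x, y) : x ∈ B, y − ψ x ∈ F}` and its fibres -/

section Fibres

variable {X Y : Type*} [AddGroup Y]

/-- The fibre of the sheared window over a base point IN `B` is the translated fibre window `(· − ψ x)⁻¹' F = ψ x + F`. [folklore] -/
theorem fibre_shearedWindow_of_mem (ψ : X → Y) (B : Set X) (F : Set Y) {x : X} (hx : x ∈ B) :
    Prod.mk x ⁻¹' {p : X × Y | p.1 ∈ B ∧ p.2 - ψ p.1 ∈ F} = (fun y => y - ψ x) ⁻¹' F := by
  ext y; simp [hx]

/-- … and EMPTY over a base point off `B`. [folklore] -/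
theorem fibre_shearedWindow_of_not_mem (ψ : X → Y) (B : Set X) (F : Set Y) {x : X} (hx : x ∉ B) :
    Prod.mk x ⁻¹' {p : X × Y | p.1 ∈ B ∧ p.2 - ψ p.1 ∈ F} = ∅ := by
  ext y; simp [hx]

omit [AddGroup Y] in
/-- The fibre of the PRODUCT window over a base point in `B` is `F` (Mathlib `mk_preimage_prod_right`, recorded in the road's shape). -/
theorem fibre_prodWindow_of_mem (B : Set X) (F : Set Y) {x : X} (hx : x ∈ B) : Prod.mk x ⁻¹' (B ×ˢ F) = F :=
  mk_preimage_prod_right hx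

/-- The sheared window is measurable when `ψ`, `B`, `F` are. [folklore] -/
theorem measurableSet_shearedWindow [MeasurableSpace X] [MeasurableSpace Y] [MeasurableSub₂ Y] {ψ : X → Y} (hψ : Measurable ψ)
    {B : Set X} (hB : MeasurableSet B) {F : Set Y} (hF : MeasurableSet F) :
    MeasurableSet {p : X × Y | p.1 ∈ B ∧ p.2 - ψ p.1 ∈ F} :=
  (measurable_fst hB).inter ((measurable_snd.sub (hψ.comp measurable_fst)) hF)

end Fibres

/-! ## §2 Translation invariance on ONE fibre -/

section Translate

variable {Y : Type*} [MeasurableSpace Y] [AddGroup Y] [MeasurableAdd Y] [MeasurableSub Y] (μ : Measure Y)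
  [μ.IsAddRightInvariant]

/-- **TRANSLATION ON A FIBRE**: `∫_{(· − c)⁻¹' F} g dμ = ∫_F g(w + c) dμ(w)` for an add-right-invariant measure (Lebesgue on `ℝⁿ`). [folklore] -/
theorem setIntegral_preimage_sub_const {F : Set Y} (hF : MeasurableSet F) (c : Y) (g : Y → ℝ) :
    ∫ y in (fun y => y - c) ⁻¹' F, g y ∂μ = ∫ w in F, g (w + c) ∂μ := by
  rw [← integral_indicator (hF.preimage (measurable_sub_const c)), ← integral_indicator hF,
    ← integral_sub_right_eq_self (fun w => F.indicator (fun w => g (w + c)) w) c]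
  congr 1
  funext y
  by_cases hy : y - c ∈ F
  · rw [indicator_of_mem hy, indicator_of_mem (show y ∈ (fun y => y - c) ⁻¹' F from hy), sub_add_cancel]
  · rw [indicator_of_notMem hy, indicator_of_notMem (show y ∉ (fun y => y - c) ⁻¹' F from hy)]

/-- Integrability on the translated fibre window ⟺ integrability of the translate on the window. [folklore] -/
theorem integrableOn_preimage_sub_const_iff {F : Set Y} (hF : MeasurableSet F) (c : Y) (g : Y → ℝ) :
    IntegrableOn g ((fun y => y - c) ⁻¹' F) μ ↔ IntegrableOn (fun w => g (w + c)) F μ := by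
  rw [← integrable_indicator_iff (hF.preimage (measurable_sub_const c)), ← integrable_indicator_iff hF]
  have e : ((fun y => y - c) ⁻¹' F).indicator g = fun y => F.indicator (fun w => g (w + c)) (y - c) := by
    funext y
    by_cases hy : y - c ∈ F
    · rw [indicator_of_mem hy, indicator_of_mem (show y ∈ (fun y => y - c) ⁻¹' F from hy), sub_add_cancel]
    · rw [indicator_of_notMem hy, indicator_of_notMem (show y ∉ (fun y => y - c) ⁻¹' F from hy)]
  rw [e]
  constructor
  · intro h
    have h' := h.comp_add_right c
    simpa only [add_sub_cancel_right] using h'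
  · intro h
    exact h.comp_sub_right c

end Translate

/-! ## §3 THE IDENTITY: fibre integrals over the sheared window = fibre integrals of the sheared integrand over the product window -/

section Identity

variable {X Y : Type*} [MeasurableSpace Y] [AddCommGroup Y] [MeasurableAdd Y] [MeasurableSub Y] (μ : Measure Y)
  [μ.IsAddRightInvariant]

/-- **THE SHEARED CHART COSTS NOTHING UNDER THE FIBRE INTEGRAL**: for `x ∈ B`,
`∫_{(K_ψ)_x} f(x, y) dμ(y) = ∫_{(B ×ˢ F)_x} f(x, ψ x + w) dμ(w)` — ANY shear `ψ`, no Jacobian. [folklore] -/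
theorem setIntegral_fibre_shearedWindow (ψ : X → Y) {B : Set X} {F : Set Y} (hF : MeasurableSet F) (f : X × Y → ℝ) {x : X}
    (hx : x ∈ B) :
    ∫ y in Prod.mk x ⁻¹' {p : X × Y | p.1 ∈ B ∧ p.2 - ψ p.1 ∈ F}, f (x, y) ∂μ =
      ∫ w in Prod.mk x ⁻¹' (B ×ˢ F), f (x, ψ x + w) ∂μ := by
  rw [fibre_shearedWindow_of_mem ψ B F hx, fibre_prodWindow_of_mem B F hx, setIntegral_preimage_sub_const μ hF (ψ x) fun y => f (x, y)]
  refine setIntegral_congr_fun hF fun w _ => ?_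
  rw [add_comm]

/-- Integrability transfers between the two fibres. [folklore] -/
theorem integrableOn_fibre_shearedWindow_iff (ψ : X → Y) {B : Set X} {F : Set Y} (hF : MeasurableSet F) (f : X × Y → ℝ) {x : X}
    (hx : x ∈ B) :
    IntegrableOn (fun y => f (x, y)) (Prod.mk x ⁻¹' {p : X × Y | p.1 ∈ B ∧ p.2 - ψ p.1 ∈ F}) μ ↔
      IntegrableOn (fun w => f (x, ψ x + w)) (Prod.mk x ⁻¹' (B ×ˢ F)) μ := by
  rw [fibre_shearedWindow_of_mem ψ B F hx, fibre_prodWindow_of_mem B F hx,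
    integrableOn_preimage_sub_const_iff μ hF (ψ x) fun y => f (x, y)]
  exact integrableOn_congr_fun (fun w _ => by rw [add_comm]) hF

/-- The `hint` letter of `…LogConcaveMarginal` §6 transfers: integrability of `e^{−V(x,·)}` on the sheared fibres over `Bs ⊆ B` ⟺ that of
`e^{−Ṽ(x,·)}`, `Ṽ(x, w) = V(x, ψ x + w)`, on the product fibres. [folklore] -/
theorem shearedWindow_hint_iff (ψ : X → Y) {B Bs : Set X} (hBs : Bs ⊆ B) {F : Set Y} (hF : MeasurableSet F) (V : X × Y → ℝ) :
    (∀ x ∈ Bs, IntegrableOn (fun y => Real.exp (-V (x, y))) (Prod.mk x ⁻¹' {p : X × Y | p.1 ∈ B ∧ p.2 - ψ p.1 ∈ F}) μ) ↔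
      ∀ x ∈ Bs, IntegrableOn (fun w => Real.exp (-V (x, ψ x + w))) (Prod.mk x ⁻¹' (B ×ˢ F)) μ :=
  forall₂_congr fun _ hx => integrableOn_fibre_shearedWindow_iff μ ψ hF (fun p => Real.exp (-V p)) (hBs hx)

/-- The `hpos` letter transfers likewise (the two fibre masses are EQUAL). [folklore] -/
theorem shearedWindow_hpos_iff (ψ : X → Y) {B Bs : Set X} (hBs : Bs ⊆ B) {F : Set Y} (hF : MeasurableSet F) (V : X × Y → ℝ) :
    (∀ x ∈ Bs, 0 < ∫ y in Prod.mk x ⁻¹' {p : X × Y | p.1 ∈ B ∧ p.2 - ψ p.1 ∈ F}, Real.exp (-V (x, y)) ∂μ) ↔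
      ∀ x ∈ Bs, 0 < ∫ w in Prod.mk x ⁻¹' (B ×ˢ F), Real.exp (-V (x, ψ x + w)) ∂μ :=
  forall₂_congr fun x hx => by rw [setIntegral_fibre_shearedWindow μ ψ hF (fun p => Real.exp (-V p)) (hBs hx)]

end Identity

/-! ## §4 END: the windowed marginals of `(V, K_ψ)` and `(Ṽ, B × F)` are the same function on `B`; secant letters transfer verbatim -/

section End

variable {X Y : Type*} [MeasurableSpace Y] [AddCommGroup Y] [MeasurableAdd Y] [MeasurableSub Y] (μ : Measure Y)
  [μ.IsAddRightInvariant]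

/-- **THE TWO MARGINALS COINCIDE ON `B`**: `−log ∫_{(K_ψ)_x} e^{−V(x, y)} dμ(y) = −log ∫_{(B ×ˢ F)_x} e^{−V(x, ψ x + w)} dμ(w)`. [folklore] -/
theorem neg_log_fibreIntegral_shearedWindow_eq (ψ : X → Y) {B : Set X} {F : Set Y} (hF : MeasurableSet F) (V : X × Y → ℝ) {x : X}
    (hx : x ∈ B) :
    -Real.log (∫ y in Prod.mk x ⁻¹' {p : X × Y | p.1 ∈ B ∧ p.2 - ψ p.1 ∈ F}, Real.exp (-V (x, y)) ∂μ) =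
      -Real.log (∫ w in Prod.mk x ⁻¹' (B ×ˢ F), Real.exp (-V (x, ψ x + w)) ∂μ) := by
  rw [setIntegral_fibre_shearedWindow μ ψ hF (fun p => Real.exp (-V p)) hx]

/-- **THE TWO MARGINALS ARE ONE FUNCTION ON `B`** (`Set.EqOn`): so every statement LOCAL ON `B` — secant letters, `ConvexOn B`,
`StrongConvexOn B`, derivatives WITHIN `B` (`…LogConcaveMarginalDeriv`, `…FibreWindowSmooth` for the product side) — transfers between the
sheared-window marginal of `V` and the product-window marginal of `Ṽ` by `EqOn`-congruence. [folklore] -/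
theorem marginal_eqOn_sheared (ψ : X → Y) {B : Set X} {F : Set Y} (hF : MeasurableSet F) (V : X × Y → ℝ) :
    EqOn (fun x => -Real.log (∫ y in Prod.mk x ⁻¹' {p : X × Y | p.1 ∈ B ∧ p.2 - ψ p.1 ∈ F}, Real.exp (-V (x, y)) ∂μ))
      (fun x => -Real.log (∫ w in Prod.mk x ⁻¹' (B ×ˢ F), Real.exp (-V (x, ψ x + w)) ∂μ)) B :=
  fun _ hx => neg_log_fibreIntegral_shearedWindow_eq μ ψ hF V hx

/-- `ConvexOn` transfers (an instance of the `EqOn` congruence): the product-window marginal of `Ṽ` is convex on `B` iff the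
sheared-window marginal of `V` is. [folklore] -/
theorem convexOn_marginal_sheared_iff [AddCommMonoid X] [Module ℝ X] (ψ : X → Y) {B : Set X} {F : Set Y} (hF : MeasurableSet F)
    (V : X × Y → ℝ) :
    ConvexOn ℝ B (fun x => -Real.log (∫ y in Prod.mk x ⁻¹' {p : X × Y | p.1 ∈ B ∧ p.2 - ψ p.1 ∈ F}, Real.exp (-V (x, y)) ∂μ)) ↔
      ConvexOn ℝ B (fun x => -Real.log (∫ w in Prod.mk x ⁻¹' (B ×ˢ F), Real.exp (-V (x, ψ x + w)) ∂μ)) :=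
  ⟨fun h => h.congr (marginal_eqOn_sheared μ ψ hF V), fun h => h.congr (marginal_eqOn_sheared μ ψ hF V).symm⟩

/-- **END — THE SECANT LETTER OF THE PRODUCT-WINDOW MARGINAL IS THE SECANT LETTER OF THE SHEARED-WINDOW MARGINAL**: for base points
`x₀, x₁ ∈ B` and a third point `z ∈ B` (the convex combination), any inequality
`M̃(z) + c ≤ a·M̃(x₀) + b·M̃(x₁)` for `M̃(x) = −log ∫_{(B ×ˢ F)_x} e^{−V(x, ψ x + w)}` (e.g. the conclusion of
`…LogConcaveMarginal.neg_log_fibreIntegral_secant_of_baseForm` for the sheared exponent on the product window, `z = a x₀ + b x₁`,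
`c = a·b·Q(x₁ − x₀)`) IS the same inequality for `M(x) = −log ∫_{(K_ψ)_x} e^{−V(x, y)}`. [folklore] -/
theorem marginal_secant_of_sheared (ψ : X → Y) {B : Set X} {F : Set Y} (hF : MeasurableSet F) (V : X × Y → ℝ) {x₀ x₁ z : X}
    (hx₀ : x₀ ∈ B) (hx₁ : x₁ ∈ B) (hz : z ∈ B) {a b c : ℝ}
    (h : -Real.log (∫ w in Prod.mk z ⁻¹' (B ×ˢ F), Real.exp (-V (z, ψ z + w)) ∂μ) + c ≤
      a * -Real.log (∫ w in Prod.mk x₀ ⁻¹' (B ×ˢ F), Real.exp (-V (x₀, ψ x₀ + w)) ∂μ) +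
        b * -Real.log (∫ w in Prod.mk x₁ ⁻¹' (B ×ˢ F), Real.exp (-V (x₁, ψ x₁ + w)) ∂μ)) :
    -Real.log (∫ y in Prod.mk z ⁻¹' {p : X × Y | p.1 ∈ B ∧ p.2 - ψ p.1 ∈ F}, Real.exp (-V (z, y)) ∂μ) + c ≤
      a * -Real.log (∫ y in Prod.mk x₀ ⁻¹' {p : X × Y | p.1 ∈ B ∧ p.2 - ψ p.1 ∈ F}, Real.exp (-V (x₀, y)) ∂μ) +
        b * -Real.log (∫ y in Prod.mk x₁ ⁻¹' {p : X × Y | p.1 ∈ B ∧ p.2 - ψ p.1 ∈ F}, Real.exp (-V (x₁, y)) ∂μ) := by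
  rw [neg_log_fibreIntegral_shearedWindow_eq μ ψ hF V hz, neg_log_fibreIntegral_shearedWindow_eq μ ψ hF V hx₀,
    neg_log_fibreIntegral_shearedWindow_eq μ ψ hF V hx₁]
  exact h

end End

/-! ## §5 (v1.2): THE CHART TERM IN SECANT CURRENCY — what a NONLINEAR shear costs the inherited base form (the (A3) «chart»
debt of refuter v101 §3 (ii), displayed in the road's own currency: fibre-Lipschitz constant `G` of `V` on the window × secant defect `κ` of
the shear; chair leaf-04 g147's second read l.56782: «the instance's chart debt is `Dψ`, `D²ψ` inside the joint letter of `Ṽ`») -/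

section ChartTerm

variable {X Y : Type*} [AddCommGroup X] [Module ℝ X] [NormedAddCommGroup Y] [NormedSpace ℝ Y]

/-- **THE CHART TERM, SECANT CURRENCY**: let `V` obey the BASE-form secant letter `V(a p + b q) + a·b·S(q₁ − p₁) ≤ a V p + b V q` on a
convex `K ⊆ X × Y`, be `G`-Lipschitz in the FIBRE direction on `K` (`|V(x, y) − V(x, y′)| ≤ G‖y − y′‖`, `G ≥ 0`), and let the shear `ψ`
have secant defect `‖ψ(a x₀ + b x₁) − (a ψ x₀ + b ψ x₁)‖ ≤ a·b·κ(x₁ − x₀)` on the convex base window `B` (for a `C²` shear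
`κ(v) = ½·sup‖D²ψ‖·‖v‖²`); the chart maps the product window into `K` (`(x, ψ x + w) ∈ K` for `x ∈ B`, `w ∈ F`, `F` convex).  Then the
SHEARED exponent `Ṽ(x, w) = V(x, ψ x + w)` obeys the base-form letter on `B ×ˢ F` with the DEGRADED form `S − G·κ`:
`Ṽ(a p̃ + b q̃) + a·b·(S − G·κ)(q̃₁ − p̃₁) ≤ a Ṽ p̃ + b Ṽ q̃` — verbatim `…LogConcaveMarginal` §6's `hVc` for `Ṽ` with base form `S − G·κ`.
The minimiser-adapted chart is the one where `G = sup_K ‖D_yV‖` is SMALL (`D_yV = 0` on the graph of the exact fibre minimiser), so the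
chart term `G·κ` is a small fraction of `S`; by value both are (A3). [folklore] -/
theorem secantForm_sheared_of_fibreLipschitz (ψ : X → Y) {B : Set X} {F : Set Y} (hB : Convex ℝ B) (hF : Convex ℝ F)
    {K : Set (X × Y)} (hK : Convex ℝ K) (hAK : ∀ x ∈ B, ∀ w ∈ F, (x, ψ x + w) ∈ K)
    {V : X × Y → ℝ} {S κ : X → ℝ} {G : ℝ} (hG0 : 0 ≤ G)
    (hV : ∀ p ∈ K, ∀ q ∈ K, ∀ a b : ℝ, 0 ≤ a → 0 ≤ b → a + b = 1 → V (a • p + b • q) + a * b * S (q.1 - p.1) ≤ a * V p + b * V q)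
    (hG : ∀ (x : X) (y y' : Y), (x, y) ∈ K → (x, y') ∈ K → |V (x, y) - V (x, y')| ≤ G * ‖y - y'‖)
    (hψ : ∀ x₀ ∈ B, ∀ x₁ ∈ B, ∀ a b : ℝ, 0 ≤ a → 0 ≤ b → a + b = 1 →
      ‖ψ (a • x₀ + b • x₁) - (a • ψ x₀ + b • ψ x₁)‖ ≤ a * b * κ (x₁ - x₀)) :
    ∀ p ∈ B ×ˢ F, ∀ q ∈ B ×ˢ F, ∀ a b : ℝ, 0 ≤ a → 0 ≤ b → a + b = 1 →
      (fun r : X × Y => V (r.1, ψ r.1 + r.2)) (a • p + b • q) + a * b * (S (q.1 - p.1) - G * κ (q.1 - p.1)) ≤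
        a * (fun r : X × Y => V (r.1, ψ r.1 + r.2)) p + b * (fun r : X × Y => V (r.1, ψ r.1 + r.2)) q := by
  intro p hp q hq a b ha hb hab
  rw [mem_prod] at hp hq
  simp only [Prod.fst_add, Prod.snd_add, Prod.smul_fst, Prod.smul_snd]
  have hxB : a • p.1 + b • q.1 ∈ B := hB hp.1 hq.1 ha hb hab
  have hwF : a • p.2 + b • q.2 ∈ F := hF hp.2 hq.2 ha hb hab
  have hPK : (p.1, ψ p.1 + p.2) ∈ K := hAK _ hp.1 _ hp.2
  have hQK : (q.1, ψ q.1 + q.2) ∈ K := hAK _ hq.1 _ hq.2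
  have hZK : (a • p.1 + b • q.1, ψ (a • p.1 + b • q.1) + (a • p.2 + b • q.2)) ∈ K := hAK _ hxB _ hwF
  -- the straight convex combination of the two charted points, and that it lies in `K`
  have hM : a • (p.1, ψ p.1 + p.2) + b • (q.1, ψ q.1 + q.2) = (a • p.1 + b • q.1, (a • ψ p.1 + b • ψ q.1) + (a • p.2 + b • q.2)) := by
    ext
    · simp
    · simp only [Prod.snd_add, Prod.smul_snd, smul_add]; abel
  have hMK : (a • p.1 + b • q.1, (a • ψ p.1 + b • ψ q.1) + (a • p.2 + b • q.2)) ∈ K := by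
    rw [← hM]; exact hK hPK hQK ha hb hab
  -- (1) the base-form letter of `V` at the charted points
  have h1 := hV _ hPK _ hQK a b ha hb hab
  rw [hM] at h1
  -- (2) the fibre-Lipschitz step across the shear's secant defect
  have h2 := hG (a • p.1 + b • q.1) (ψ (a • p.1 + b • q.1) + (a • p.2 + b • q.2)) ((a • ψ p.1 + b • ψ q.1) + (a • p.2 + b • q.2))
    hZK hMK
  have hδ : ‖ψ (a • p.1 + b • q.1) + (a • p.2 + b • q.2) - ((a • ψ p.1 + b • ψ q.1) + (a • p.2 + b • q.2))‖ ≤ a * b * κ (q.1 - p.1) := by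
    rw [show ψ (a • p.1 + b • q.1) + (a • p.2 + b • q.2) - ((a • ψ p.1 + b • ψ q.1) + (a • p.2 + b • q.2)) =
        ψ (a • p.1 + b • q.1) - (a • ψ p.1 + b • ψ q.1) by abel]
    exact hψ p.1 hp.1 q.1 hq.1 a b ha hb hab
  have h3 : V (a • p.1 + b • q.1, ψ (a • p.1 + b • q.1) + (a • p.2 + b • q.2)) -
      V (a • p.1 + b • q.1, (a • ψ p.1 + b • ψ q.1) + (a • p.2 + b • q.2)) ≤ G * (a * b * κ (q.1 - p.1)) :=
    (le_abs_self _).trans (h2.trans (mul_le_mul_of_nonneg_left hδ hG0))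
  nlinarith [h1, h3]

end ChartTerm

/-! ## Toy check (kernel): the sheared window is genuinely not a product -/

/-- Toy: with `B = F = [0, 1] ⊆ ℝ` and the shear `ψ(x) = x`, the point `(1, 3∕2)` lies in `K_ψ` (`3∕2 − 1 ∈ [0, 1]`) although
`3∕2 ∉ F` — the sheared window is NOT the product `B × F`. -/
example : ((1 : ℝ), (3 / 2 : ℝ)) ∈ {p : ℝ × ℝ | p.1 ∈ Icc (0 : ℝ) 1 ∧ p.2 - p.1 ∈ Icc (0 : ℝ) 1} ∧ (3 / 2 : ℝ) ∉ Icc (0 : ℝ) 1 := by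
  refine ⟨⟨⟨by norm_num, by norm_num⟩, ?_, ?_⟩, fun h => ?_⟩ <;> norm_num at *

end Summit.QuantumFields.BalabanUV.T4Continuum.NE7b.ShearedWindowMarginal
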